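import Summits.RiemannHypothesis.RiemannHypothesis.Theses.SpectralTrace
import Literature.NumberTheory.LFunctions.WeilArchimedeanPositivityProofs
import HarnessLib

/-!
# `WindowTraceArch` — negative lemma: unit masses and the spectral exclusion inequality

Support lemmas for the crux `stmt-RiemannHypothesis-11195`
(`Summit.RiemannHypothesis.RiemannHypothesis.Theses.SpectralTrace.WindowTraceArch`), recorded by
the standing disprover (`Cruxes/WindowTraceArch/Disproof.lean` §2c): the INTEGRALITY of the
masses made quantitative. For a real family `γ` reproducing `W` on the Weil tests supported in
`[-A, A]` and any Weil test `g` supported in the half window `[-A/2, A/2]`: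

* `hasSum_norm_sq_of_windowTrace` : `HasSum (i ↦ |ĝ(1/2+iγ_i)|²) (Re Q(g))`, `Q(g) = W(g ⋆ g̃)`
  (`weilMellin_weilConv_weilReflect_half`);
* `sum_norm_sq_le_of_windowTrace`, `norm_sq_le_of_windowTrace` : every finite partial sum, in
  particular every SINGLE term, is `≤ Re Q(g)` — a unit atom at `γ_j` costs `|ĝ(1/2+iγ_j)|²`;
* `card_mul_norm_sq_le_of_windowTrace` : multiplicity bound `m(γ₀) · |ĝ(1/2+iγ₀)|² ≤ Re Q(g)`;
* `not_mem_range_of_windowTrace` : FORBIDDEN ZONE — if some half-window test has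
  `Re Q(g) < |ĝ(1/2+iγ₀)|²` then `γ₀` is a value of NO window family (the reproducing-kernel
  condition `K_A(γ₀) := sup_g |ĝ(1/2+iγ₀)|²/Q(g) ≤ 1/m(γ₀)` of the Kreĭn–de Branges picture).

Weighted (Kreĭn) realisations satisfy no such bound; this is exactly what separates them from
the crux.
-/

noncomputable section

open Complex Set MeasureTheory

namespace Summit.RiemannHypothesis.RiemannHypothesis.Theorems.WindowTraceArch.Negative

open Literature.NumberTheory.LFunctions

variable {A : ℝ} {ι : Type*} {γ : ι → ℝ} {g : ℝ → ℂ}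

/-- **Bochner form of the window trace on the half window.** For a window-trace family and a
Weil test `g` supported in `[-A/2, A/2]`: `HasSum (i ↦ |ĝ(1/2+iγ_i)|²) (Re Q(g))`. [folklore] -/
theorem hasSum_norm_sq_of_windowTrace
    (h : ∀ g : ℝ → ℂ, IsWeilTest g → tsupport g ⊆ Icc (-A) A →
      HasSum (fun i => weilMellin g (1 / 2 + (γ i : ℂ) * I)) (weilFunctional g))
    (hg : IsWeilTest g) (hgs : tsupport g ⊆ Icc (-(A / 2)) (A / 2)) :
    HasSum (fun i => ‖weilMellin g (1 / 2 + (γ i : ℂ) * I)‖ ^ 2) (weilQuadratic g).re := by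
  have hk : IsWeilTest (weilConv g (weilReflect g)) := hg.weilConv hg.weilReflect
  have hks : tsupport (weilConv g (weilReflect g)) ⊆ Icc (-A) A :=
    (tsupport_weilConv_weilReflect_subset hg.2 hgs).trans
      (Icc_subset_Icc (by linarith) (by linarith))
  have hsumC : HasSum (fun i => (((‖weilMellin g (1 / 2 + (γ i : ℂ) * I)‖ ^ 2 : ℝ) : ℂ)))
      (weilFunctional (weilConv g (weilReflect g))) := by
    simpa only [weilMellin_weilConv_weilReflect_half hg] using h _ hk hks
  have hsumR : HasSum (fun i => ‖weilMellin g (1 / 2 + (γ i : ℂ) * I)‖ ^ 2)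
      (weilFunctional (weilConv g (weilReflect g))).re := by
    simpa only [Complex.reCLM_apply, Complex.ofReal_re] using hsumC.mapL Complex.reCLM
  unfold weilQuadratic
  exact hsumR

/-- Every finite partial sum of the squared transform is bounded by the energy `Re Q(g)`.
[folklore] -/
theorem sum_norm_sq_le_of_windowTrace
    (h : ∀ g : ℝ → ℂ, IsWeilTest g → tsupport g ⊆ Icc (-A) A →
      HasSum (fun i => weilMellin g (1 / 2 + (γ i : ℂ) * I)) (weilFunctional g))
    (hg : IsWeilTest g) (hgs : tsupport g ⊆ Icc (-(A / 2)) (A / 2)) (s : Finset ι) :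
    ∑ i ∈ s, ‖weilMellin g (1 / 2 + (γ i : ℂ) * I)‖ ^ 2 ≤ (weilQuadratic g).re :=
  sum_le_hasSum s (fun _ _ => by positivity) (hasSum_norm_sq_of_windowTrace h hg hgs)

/-- **Unit masses**: a single atom at `γ_j` already costs `|ĝ(1/2+iγ_j)|² ≤ Re Q(g)` for
every half-window test `g`. [folklore] -/
theorem norm_sq_le_of_windowTrace
    (h : ∀ g : ℝ → ℂ, IsWeilTest g → tsupport g ⊆ Icc (-A) A →
      HasSum (fun i => weilMellin g (1 / 2 + (γ i : ℂ) * I)) (weilFunctional g))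
    (hg : IsWeilTest g) (hgs : tsupport g ⊆ Icc (-(A / 2)) (A / 2)) (j : ι) :
    ‖weilMellin g (1 / 2 + (γ j : ℂ) * I)‖ ^ 2 ≤ (weilQuadratic g).re := by
  simpa using sum_norm_sq_le_of_windowTrace h hg hgs {j}

/-- **Multiplicity bound**: if `s` is a finite set of indices all carrying the value `γ₀`,
then `#s · |ĝ(1/2+iγ₀)|² ≤ Re Q(g)` (so the multiplicity of `γ₀` is at most
`Re Q(g) / |ĝ(1/2+iγ₀)|²` for every half-window test). [folklore] -/
theorem card_mul_norm_sq_le_of_windowTrace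
    (h : ∀ g : ℝ → ℂ, IsWeilTest g → tsupport g ⊆ Icc (-A) A →
      HasSum (fun i => weilMellin g (1 / 2 + (γ i : ℂ) * I)) (weilFunctional g))
    (hg : IsWeilTest g) (hgs : tsupport g ⊆ Icc (-(A / 2)) (A / 2)) {γ₀ : ℝ} (s : Finset ι)
    (hs : ∀ i ∈ s, γ i = γ₀) :
    (s.card : ℝ) * ‖weilMellin g (1 / 2 + (γ₀ : ℂ) * I)‖ ^ 2 ≤ (weilQuadratic g).re := by
  have h1 := sum_norm_sq_le_of_windowTrace h hg hgs s
  have h2 : ∑ i ∈ s, ‖weilMellin g (1 / 2 + (γ i : ℂ) * I)‖ ^ 2 =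
      ∑ _i ∈ s, ‖weilMellin g (1 / 2 + (γ₀ : ℂ) * I)‖ ^ 2 :=
    Finset.sum_congr rfl fun i hi => by rw [hs i hi]
  rw [h2, Finset.sum_const, nsmul_eq_mul] at h1
  exact h1

/-- **Forbidden zone.** If some Weil test `g` supported in `[-A/2, A/2]` has
`Re Q(g) < |ĝ(1/2+iγ₀)|²`, then `γ₀` is a value of NO family reproducing `W` on `[-A, A]`.
[folklore] -/
theorem not_mem_range_of_windowTrace
    (h : ∀ g : ℝ → ℂ, IsWeilTest g → tsupport g ⊆ Icc (-A) A →
      HasSum (fun i => weilMellin g (1 / 2 + (γ i : ℂ) * I)) (weilFunctional g))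
    (hg : IsWeilTest g) (hgs : tsupport g ⊆ Icc (-(A / 2)) (A / 2)) {γ₀ : ℝ}
    (hlt : (weilQuadratic g).re < ‖weilMellin g (1 / 2 + (γ₀ : ℂ) * I)‖ ^ 2) :
    γ₀ ∉ Set.range γ := by
  rintro ⟨j, rfl⟩
  exact not_lt.2 (norm_sq_le_of_windowTrace h hg hgs j) hlt

/-- The crux window `A = log 2`: forbidden zone for `WindowTraceArch` witnesses from tests
supported in `[-(log 2)/2, (log 2)/2]`. [folklore] -/
theorem not_mem_range_of_windowTraceArch_witness {ι : Type} {γ : ι → ℝ}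
    (h : ∀ g : ℝ → ℂ, IsWeilTest g → tsupport g ⊆ Icc (-Real.log 2) (Real.log 2) →
      HasSum (fun i => weilMellin g (1 / 2 + (γ i : ℂ) * I)) (weilFunctional g))
    {g : ℝ → ℂ} (hg : IsWeilTest g)
    (hgs : tsupport g ⊆ Icc (-(Real.log 2 / 2)) (Real.log 2 / 2)) {γ₀ : ℝ}
    (hlt : (weilQuadratic g).re < ‖weilMellin g (1 / 2 + (γ₀ : ℂ) * I)‖ ^ 2) :
    γ₀ ∉ Set.range γ :=
  not_mem_range_of_windowTrace h hg hgs hlt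

/-- The crux window: multiplicity bound for `WindowTraceArch` witnesses. [folklore] -/
theorem card_mul_norm_sq_le_of_windowTraceArch_witness {ι : Type} {γ : ι → ℝ}
    (h : ∀ g : ℝ → ℂ, IsWeilTest g → tsupport g ⊆ Icc (-Real.log 2) (Real.log 2) →
      HasSum (fun i => weilMellin g (1 / 2 + (γ i : ℂ) * I)) (weilFunctional g))
    {g : ℝ → ℂ} (hg : IsWeilTest g)
    (hgs : tsupport g ⊆ Icc (-(Real.log 2 / 2)) (Real.log 2 / 2)) {γ₀ : ℝ} (s : Finset ι)
    (hs : ∀ i ∈ s, γ i = γ₀) :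
    (s.card : ℝ) * ‖weilMellin g (1 / 2 + (γ₀ : ℂ) * I)‖ ^ 2 ≤ (weilQuadratic g).re :=
  card_mul_norm_sq_le_of_windowTrace h hg hgs s hs

end Summit.RiemannHypothesis.RiemannHypothesis.Theorems.WindowTraceArch.Negative

end
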